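import Summits.CriticalPhenomena.SAWScalingLimit.Theorems.SAWDevelopingMapHexConjectureAvoidanceCocycle
import HarnessLib

/-!
# Crux `HexConjecture` (stmt-CriticalPhenomena-0808), line `root-locality-replaces-loewner`:
the uniform injectivity modulus implies non-retracing (floor class)

Landing target:
`Summits/CriticalPhenomena/SAWScalingLimit/Theorems/SAWDevelopingMapHexConjectureNonRetracingOfModulus.lean`
(`--supports stmt-CriticalPhenomena-0808`).

The line closes Duminil-Copin–Smirnov's Conjecture 1 on the FLOOR class (Jordan domains above the
horizontal line through the two marks, flat radius-`ρ` half-discs at both marks, discrete-boundary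
endpoints) from range convergence plus ONE regularity input, the registered open stub
`stub_nonRetracingFloor` ("non-retracing": for `ℓ, η > 0` there is `ε > 0` such that, for all small
meshes, the critical hexagonal SAW has an `(ε, ℓ)`-triple strand — three parameter-disjoint
sub-arcs of diameter `≥ ℓ` pairwise at Hausdorff distance `≤ ε` — with probability `≤ η`).
Crux stmt-CriticalPhenomena-10472's floor line isolates instead the UNIFORM INJECTIVITY MODULUS
(its registered open stub `stub_uniformModulus`: for `ε', η > 0` there is `θ > 0` with
`P_δ[curve ∉ CurveClass.modulusClass ε' θ] ≤ η` for all small meshes).  This file records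

* `nonRetracingFloor_of_uniformModulus : stub_uniformModulus → stub_nonRetracingFloor`
  (both statements verbatim),

so that the two cruxes share ONE open regularity estimate.

The deterministic core (`diam_middleStrand_le_of_mem_modulusSet`, any pseudo-metric space):
if a curve `c` has injectivity modulus `(ε', θ)` and `[s₀, t₀] < [s₁, t₁] < [s₂, t₂]` are three
parameter intervals whose images `K₀, K₁, K₂` are pairwise at Hausdorff distance `≤ ε` with
`2ε < θ`, then `diam K₁ ≤ 2ε'`.  Indeed, with `u := s₁`, compactness of `K₀` and `K₂` gives
`v₀ ∈ [s₀, t₀]` and `v₂ ∈ [s₂, t₂]` with `dist (c u) (c vᵢ) = infDist (c u) Kᵢ ≤ hausdorffDist K₁ Kᵢ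
≤ ε`, so `dist (c v₀) (c v₂) ≤ 2ε < θ`; since `v₀ ≤ w ≤ v₂` for every `w ∈ [s₁, t₁]`, the modulus
gives `dist (c v₀) (c w) ≤ ε'`, whence `diam K₁ ≤ 2ε'`.  Consequently an `(ε, ℓ)`-triple strand
(`diam Kᵢ ≥ ℓ > 0`) is incompatible with the modulus `(ℓ/3, θ)` as soon as `2ε < θ`
(`mk_notMem_modulusClass_of_tripleStrand`; every representative of a class in
`modulusClass` has the modulus, `CurveClass.mem_modulusSet_of_mk_mem`).  The measure step feeds
`stub_uniformModulus` with `ε' := ℓ/3` — its floor-vertex endpoint clause follows from the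
discrete-boundary clause by `stub_avoidanceCocycle_floorEndpoint` inside the flat balls
(`eventually_adj_mem_ball`) — and answers `ε := θ/3`.

References: M. Aizenman, A. Burchard, *Hölder regularity and dimension bounds for random curves*,
Duke Math. J. **99** (1999), §2 (curve space, regularity via moduli); H. Duminil-Copin,
S. Smirnov, Ann. of Math. **175** (2012), Conjecture 1.  All statements here are elementary
metric topology; tagged [folklore].
-/

noncomputable section

open scoped Topology NNReal ENNReal unitInterval
open Filter Set Metric MeasureTheory
open Literature.Probability.LatticeModels (HexVertex hexGraph hexCenter)
open Literature.Probability.RandomPlanarGeometry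
open Literature.Probability.RandomPlanarGeometry.SAW
open Summit.CriticalPhenomena.SAWScalingLimit.Theorems.ObservableToSLE.FloorRatio
  (eventually_adj_mem_ball)

namespace Summit.CriticalPhenomena.SAWScalingLimit.Theorems.HexConjecture.RootLocality

/-! ### The deterministic core: a modulus kills the middle strand -/

/-- **A curve with injectivity modulus `(ε', θ)` has no wide middle strand.**  If
`[s 0, t 0] < [s 1, t 1] < [s 2, t 2]` are three parameter intervals of a curve `c` with modulus
`(ε', θ)` whose images are pairwise at Hausdorff distance `≤ ε`, `2ε < θ`, then the middle image has
diameter `≤ 2ε'`: the point `c (s 1)` is `ε`-close to points `c v₀`, `c v₂` of the outer images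
(compactness realises the infimum distance, which is at most the Hausdorff distance), so
`dist (c v₀) (c v₂) ≤ 2ε < θ` and the modulus pins the whole arc `c [v₀, v₂] ⊇ c [s 1, t 1]`
within `ε'` of `c v₀`. [folklore] -/
theorem diam_middleStrand_le_of_mem_modulusSet {E : Type*} [PseudoMetricSpace E]
    {c : Curve E} {ε ε' θ : ℝ} (hc : c ∈ (Curve.modulusSet ε' θ : Set (Curve E)))
    (hεθ : 2 * ε < θ) {s t : Fin 3 → I} (hst : ∀ i, s i ≤ t i) (h01 : t 0 < s 1)
    (h12 : t 1 < s 2)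
    (hH : ∀ i j, hausdorffDist ((⇑c) '' Icc (s i) (t i)) ((⇑c) '' Icc (s j) (t j)) ≤ ε) :
    diam ((⇑c) '' Icc (s 1) (t 1)) ≤ 2 * ε' := by
  -- the three images are nonempty compact sets
  set K : Fin 3 → Set E := fun i => (⇑c) '' Icc (s i) (t i) with hK
  have hKc : ∀ i, IsCompact (K i) := fun i => isCompact_Icc.image c.continuous
  have hKne : ∀ i, (K i).Nonempty := fun i => ⟨c (s i), s i, ⟨le_rfl, hst i⟩, rfl⟩
  have hfin : ∀ i j, hausdorffEDist (K i) (K j) ≠ ⊤ := fun i j =>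
    hausdorffEDist_ne_top_of_nonempty_of_bounded (hKne i) (hKne j) (hKc i).isBounded
      (hKc j).isBounded
  -- the base point `c (s 1)` of the middle strand and its `ε`-close companions
  have hu : c (s 1) ∈ K 1 := ⟨s 1, ⟨le_rfl, hst 1⟩, rfl⟩
  have hclose : ∀ i, ∃ v ∈ Icc (s i) (t i), dist (c (s 1)) (c v) ≤ ε := by
    intro i
    obtain ⟨y, hy, hyd⟩ := (hKc i).exists_infDist_eq_dist (hKne i) (c (s 1))
    obtain ⟨v, hv, rfl⟩ := hy
    refine ⟨v, hv, ?_⟩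
    rw [← hyd]
    exact (infDist_le_hausdorffDist_of_mem hu (hfin 1 i)).trans (hH 1 i)
  obtain ⟨v₀, hv₀, hd₀⟩ := hclose 0
  obtain ⟨v₂, hv₂, hd₂⟩ := hclose 2
  have hd02 : dist (c v₀) (c v₂) < θ :=
    calc dist (c v₀) (c v₂) ≤ dist (c (s 1)) (c v₀) + dist (c (s 1)) (c v₂) :=
          dist_triangle_left _ _ _
      _ ≤ ε + ε := add_le_add hd₀ hd₂
      _ < θ := by linarith
  -- the modulus pins the middle strand near `c v₀`
  have hpin : ∀ w ∈ Icc (s 1) (t 1), dist (c v₀) (c w) ≤ ε' := fun w hw =>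
    hc v₀ w v₂ ((hv₀.2.trans h01.le).trans hw.1) ((hw.2.trans h12.le).trans hv₂.1) hd02
  have hε' : 0 ≤ ε' := dist_nonneg.trans (hpin (s 1) ⟨le_rfl, hst 1⟩)
  refine diam_le_of_forall_dist_le (by linarith) ?_
  rintro _ ⟨w, hw, rfl⟩ _ ⟨w', hw', rfl⟩
  calc dist (c w) (c w') ≤ dist (c v₀) (c w) + dist (c v₀) (c w') := dist_triangle_left _ _ _
    _ ≤ ε' + ε' := add_le_add (hpin w hw) (hpin w' hw')
    _ = 2 * ε' := by ring

/-- **A triple strand excludes the modulus.**  A curve with an `(ε, ℓ)`-triple strand (three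
parameter-disjoint sub-arcs of diameter `≥ ℓ > 0`, pairwise at Hausdorff distance `≤ ε`) represents
a class OUTSIDE `CurveClass.modulusClass (ℓ / 3) θ` whenever `2ε < θ`: every representative of a
class in `modulusClass` has the modulus (`CurveClass.mem_modulusSet_of_mk_mem`), and the modulus
would force `diam (middle strand) ≤ 2ℓ/3 < ℓ`. [folklore] -/
theorem mk_notMem_modulusClass_of_tripleStrand {E : Type*} [MetricSpace E] {c : Curve E}
    {ℓ ε θ : ℝ} (hℓ : 0 < ℓ) (hεθ : 2 * ε < θ) {s t : Fin 3 → I} (hst : ∀ i, s i ≤ t i)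
    (h01 : t 0 < s 1) (h12 : t 1 < s 2) (hdiam : ∀ i, ℓ ≤ diam ((⇑c) '' Icc (s i) (t i)))
    (hH : ∀ i j, hausdorffDist ((⇑c) '' Icc (s i) (t i)) ((⇑c) '' Icc (s j) (t j)) ≤ ε) :
    CurveClass.mk c ∉ (CurveClass.modulusClass (ℓ / 3) θ : Set (CurveClass E)) := by
  intro hmem
  have h := diam_middleStrand_le_of_mem_modulusSet
    (CurveClass.mem_modulusSet_of_mk_mem hmem) hεθ hst h01 h12 hH
  linarith [hdiam 1]

/-! ### The measure step -/

/-- **Uniform injectivity modulus ⟹ non-retracing (floor class).**  The hypothesis is crux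
stmt-CriticalPhenomena-10472's registered open stub `stub_uniformModulus` VERBATIM (for floor
domains and floor-vertex endpoint approximations, `P_δ[curve ∉ modulusClass ε' θ] ≤ η` eventually,
for some `θ = θ(ε', η) > 0`); the conclusion is this line's registered open stub
`stub_nonRetracingFloor` VERBATIM (for floor domains and discrete-boundary endpoint approximations,
`P_δ[(ε, ℓ)-triple strand] ≤ η` eventually, for some `ε = ε(ℓ, η) > 0`).  Proof: discrete-boundary
endpoints inside the flat balls are floor vertices (`stub_avoidanceCocycle_floorEndpoint`,
`eventually_adj_mem_ball`); take `θ` for `ε' := ℓ / 3` and answer `ε := θ / 3`; the triple-strand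
event is contained in `{curve ∉ modulusClass (ℓ/3) θ}`
(`mk_notMem_modulusClass_of_tripleStrand`). [folklore] -/
theorem nonRetracingFloor_of_uniformModulus :
    (∀ (D : DobrushinDomain) (ρ : ℝ) (a b : ℝ → HexVertex),
      (0 < ρ ∧ (D.pt 1).im = (D.pt 0).im ∧ D.carrier ⊆ {z : ℂ | (D.pt 0).im < z.im} ∧
      D.carrier ∩ ball (D.pt 0) ρ = {z : ℂ | (D.pt 0).im < z.im} ∩ ball (D.pt 0) ρ ∧
      D.carrier ∩ ball (D.pt 1) ρ = {z : ℂ | (D.pt 1).im < z.im} ∩ ball (D.pt 1) ρ) →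
      (IsEmbEndpointApprox hexGraph hexCenter D a b ∧ ∀ᶠ δ : ℝ in 𝓝[>] 0,
      (∃ u : HexVertex, hexGraph.Adj (a δ) u ∧ ((δ : ℂ) * hexCenter u).im ≤ (D.pt 0).im) ∧
      (∃ u : HexVertex, hexGraph.Adj (b δ) u ∧ ((δ : ℂ) * hexCenter u).im ≤ (D.pt 1).im)) →
      ∀ ε η : ℝ, 0 < ε → 0 < η → ∃ θ : ℝ, 0 < θ ∧ ∀ᶠ δ : ℝ in 𝓝[>] 0,
        hexSAWLaw D.carrier δ (a δ) (b δ) {γ | γ.curve ∉ CurveClass.modulusClass ε θ} ≤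
          ENNReal.ofReal η) →
    ∀ (D : DobrushinDomain) (ρ : ℝ) (a b : ℝ → HexVertex),
      (0 < ρ ∧ (D.pt 1).im = (D.pt 0).im ∧ D.carrier ⊆ {z : ℂ | (D.pt 0).im < z.im} ∧
        D.carrier ∩ Metric.ball (D.pt 0) ρ = {z : ℂ | (D.pt 0).im < z.im} ∩ Metric.ball (D.pt 0) ρ ∧
        D.carrier ∩ Metric.ball (D.pt 1) ρ = {z : ℂ | (D.pt 1).im < z.im} ∩ Metric.ball (D.pt 1) ρ) →
      IsEmbEndpointApprox hexGraph hexCenter D a b →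
      (∀ᶠ δ : ℝ in 𝓝[>] 0,
        (a δ ∈ embMeshDomain hexGraph hexCenter D.carrier δ ∧
          ∃ w, hexGraph.Adj (a δ) w ∧ ¬ (hexDomainGraph D.carrier δ).Adj (a δ) w) ∧
        (b δ ∈ embMeshDomain hexGraph hexCenter D.carrier δ ∧
          ∃ w, hexGraph.Adj (b δ) w ∧ ¬ (hexDomainGraph D.carrier δ).Adj (b δ) w)) →
      ∀ ℓ : ℝ, 0 < ℓ → ∀ η : ℝ, 0 < η → ∃ ε : ℝ, 0 < ε ∧ ∀ᶠ δ : ℝ in 𝓝[>] 0,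
        hexSAWLaw D.carrier δ (a δ) (b δ)
          {γ | ∃ c : Curve ℂ, CurveClass.mk c = γ.curve ∧ ∃ s t : Fin 3 → unitInterval,
            (∀ i, s i ≤ t i) ∧ t 0 < s 1 ∧ t 1 < s 2 ∧
            (∀ i, ℓ ≤ Metric.diam ((⇑c) '' Set.Icc (s i) (t i))) ∧
            ∀ i j, Metric.hausdorffDist ((⇑c) '' Set.Icc (s i) (t i))
              ((⇑c) '' Set.Icc (s j) (t j)) ≤ ε} ≤ ENNReal.ofReal η := by
  intro hUIM D ρ a b hfl hab hbd ℓ hℓ η hη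
  have hρ : 0 < ρ := hfl.1
  have hflat0 := hfl.2.2.2.1
  have hflat1 := hfl.2.2.2.2
  -- the discrete-boundary endpoints are floor vertices
  have hend : IsEmbEndpointApprox hexGraph hexCenter D a b ∧ ∀ᶠ δ : ℝ in 𝓝[>] 0,
      (∃ u : HexVertex, hexGraph.Adj (a δ) u ∧ ((δ : ℂ) * hexCenter u).im ≤ (D.pt 0).im) ∧
      (∃ u : HexVertex, hexGraph.Adj (b δ) u ∧ ((δ : ℂ) * hexCenter u).im ≤ (D.pt 1).im) := by
    refine ⟨hab, ?_⟩
    filter_upwards [hbd, eventually_adj_mem_ball hρ hab.tendsto_fst,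
      eventually_adj_mem_ball hρ hab.tendsto_snd] with δ h hBa hBb
    obtain ⟨⟨haΩ, wa, hwa, hna⟩, ⟨hbΩ, wb, hwb, hnb⟩⟩ := h
    exact ⟨⟨wa, hwa, stub_avoidanceCocycle_floorEndpoint _ _ _ _ _ _ hflat0 (hBa _ (Or.inl rfl))
        (hBa _ (Or.inr hwa)) haΩ hwa hna⟩,
      ⟨wb, hwb, stub_avoidanceCocycle_floorEndpoint _ _ _ _ _ _ hflat1 (hBb _ (Or.inl rfl))
        (hBb _ (Or.inr hwb)) hbΩ hwb hnb⟩⟩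
  -- the modulus `(ℓ / 3, θ)` and the answer `ε := θ / 3`
  obtain ⟨θ, hθ, hθb⟩ := hUIM D ρ a b hfl hend (ℓ / 3) η (by positivity) hη
  refine ⟨θ / 3, by positivity, ?_⟩
  filter_upwards [hθb] with δ hδ
  refine (measure_mono ?_).trans hδ
  rintro γ ⟨c, hc, s, t, hst, h01, h12, hdiam, hH⟩
  show γ.curve ∉ CurveClass.modulusClass (ℓ / 3) θ
  rw [← hc]
  exact mk_notMem_modulusClass_of_tripleStrand hℓ (by linarith) hst h01 h12 hdiam hH

end Summit.CriticalPhenomena.SAWScalingLimit.Theorems.HexConjecture.RootLocality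

end
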